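import Literature.MathematicalPhysics.QuantumFieldTheory.BalabanImbrieJaffe1984to88.BIJ88MayerExchange5134

/-!
# `BalabanImbrieJaffe1984to88.BIJ88MayerCombinatoric307` — T. Bałaban, J. Imbrie, A. Jaffe, *Effective action and cluster properties of the
abelian Higgs model*, Commun. Math. Phys. **114** (1988) 257–315 [BalabanImbrieJaffe1988], §5.13 p. 307 [PDF 51], the located sentence
*"Estimating the sums over S_Y, S_5, and the sums in the cluster expansion leads to combinatoric factors exp((e^β(L^kε/ε₀)^{1/4−α})^{β′}|X_α|),
β′ > 0."* — ITS MAYER-SUM HALF PROVED for the resummed activities of this seat's `BIJ88MayerExchange5134` (`g₂(X) = Σ_{T ⊆ 𝒫(X)} g₁(X; T) =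
g₂ᴬ(X) + g₂ᴮ(X)`): if every Mayer polymer joined into the cluster costs a factor (p. 307 ¶1: *"Each time some cubes are joined into one □_i by an
e^{−V^{(k)}(Y)} − 1 or an e^{−W^{(k)}_5(X)} − 1, we get a factor e^β(L^kε/ε₀)^{1/4−α} or e^{−cr(e_k)}"*), i.e. `|g₁(X; T)| ≤ C(X)·Π_{Y∈T} a_Y`, then
the sum over the Mayer data inside `X` costs at most `Π_{Y ⊆ X}(1 + a_Y) ≤ exp(Σ_{Y ⊆ X} a_Y) ≤ exp(κ|X|)`, `κ = sup_x Σ_{Y ∋ x} a_Y` (the printed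
`(e^β(L^kε/ε₀)^{1/4−α})^{β′}`): `|g₂(X)|, |g₂ᴬ(X)|, |g₂ᴮ(X)| ≤ C(X)·exp(κ|X|)`; over a filling of Λ₁₀ these factors multiply to `exp(κ|Λ₁₀|)` — p. 307
§5.14 ¶1 *"the basic volume dependence or pressure for our expansion is naively of the order of (e^β(L^kε/ε₀)^{1/4−α})^{β′}"*.

statement-level skeleton of published theorems with citation tags; proofs where landed; nothing here is a claim about the Yang–Mills mass gap

PDF held: `paper:balaban1988-cmp114-bij-abelian-higgs-effective-action` (journal page = PDF page + 256); p. 307 = PDF 51 (rendered and read as an image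
this session, `renders/original-p051-x2.png` of the p25 seat).

**The print (verbatim, p. 307).** *"Let us estimate g₂(X_α) now. Each time some cubes are joined into one □_i by an e^{−V^{(k)}(Y)} − 1 or an
e^{−W^{(k)}_5(X)} − 1, we get a factor e^β(L^kε/ε₀)^{1/4−α} or e^{−cr(e_k)}. … Altogether, we typically get at least a small power of e^β(L^kε/ε₀)^{1/4−α} in
every cube of X_α. … Estimating the sums over S_Y, S_5, and the sums in the cluster expansion leads to combinatoric factors
exp((e^β(L^kε/ε₀)^{1/4−α})^{β′}|X_α|), β′ > 0. Such factors are easily beaten by the small factors described above for nonexceptional cubes."* p. 307,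
§5.14: *"The estimates in the last section show that the basic volume dependence or pressure for our expansion is naively of the order of
(e^β(L^kε/ε₀)^{1/4−α})^{β′}."*

**What is proved (0 `sorry`, standard axioms, 0 definitions, 0 new `Prop` facts; real inequalities).** Setting of `BIJ88MayerExchange5134`: Mayer
polymers `Ys` (nonempty sets of cubes), `polysIn Ys X` those inside `X`, fixed-Mayer-data activities `g X T : ℝ`, resummed `g2 Ys g X` /
`gA J₀ Ys g X` / `gB J₀ Ys g X`.
* §1 `sum_powerset_prod_eq` (`Σ_{T⊆U} Π_{Y∈T} a_Y = Π_{Y∈U}(1 + a_Y)`), `prod_one_add_le_exp_sum` (`≤ exp Σ a_Y` for `a ≥ 0`), `abs_sum_filter_le`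
  (any sub-sum of the Mayer data: `|Σ_{T, p T} g X T| ≤ C·Π(1 + a_Y)` under `|g X T| ≤ C·Π_{Y∈T} a_Y`), **`abs_g2_le`** / `abs_gA_le` / `abs_gB_le`,
  **`abs_g2_le_exp`** (`|g₂(X)| ≤ C·exp(Σ_{Y⊆X} a_Y)`).
* §2 THE PER-CUBE COUNT: `le_sum_ite_mem` (a nonempty polymer is counted at least once by its cubes), **`sum_polysIn_le_card_mul`**
  (`Σ_{Y ⊆ X} a_Y ≤ |X|·κ` when every cube lies in polymers of total weight `≤ κ`), **`abs_g2_le_exp_card`** / `abs_gA_le_exp_card` / `abs_gB_le_exp_card`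
  — the printed combinatoric factor `exp(κ|X_α|)`.
* §3 THE NAIVE PRESSURE: `prod_exp_mul_card` (over a filling `Q` of `W`, `Π_{X∈Q} exp(κ|X|) = exp(κ|W|)`), **`prod_abs_g2_le`**
  (`Π_{X∈Q} |g₂(X)| ≤ (Π_{X∈Q} C X)·exp(κ|W|)`).

**Honest scope.** Only the MAYER-SUM part of the sentence (the sums over S_Y, S_5 at a fixed polymer); the *"sums in the cluster expansion"* (walks,
partitions, factorials, *"as in [9]"*) are the bound on `g₁(X; T)` itself, entered as the hypothesis `hg`; the identification `κ = (e^β(L^kε/ε₀)^{1/4−α})^{β′}`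
is the per-polymer smallness of p. 307 ¶1 (rows C2.Eq5.13.1-5.13.2 `IneqVY`, (5.11.1)), not re-derived. NOT summit progress; NOT continuum; NOT Clay.
Imports: `BIJ88MayerExchange5134` only; modifies nothing. Cell `lit-balaban` Phase 2, seat p25 gen 9; row C2.Claim@307 (owner r16, referee ref-5).
-/

open Finset
open Literature.Probability.LatticeModels (IsSetPartition setPartitions mem_setPartitions)
open Literature.MathematicalPhysics.QuantumFieldTheory.BalabanImbrieJaffe1984to88.BIJ88Resummation5141 (polysIn mem_polysIn g2)
open Literature.MathematicalPhysics.QuantumFieldTheory.BalabanImbrieJaffe1984to88.BIJ88MayerExchange5134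

namespace Literature.MathematicalPhysics.QuantumFieldTheory.BalabanImbrieJaffe1984to88.BIJ88MayerCombinatoric307

variable {ι : Type*} [DecidableEq ι]

/-! ## §1 The sum over the Mayer data inside a polymer costs `Π_{Y ⊆ X}(1 + a_Y) ≤ exp(Σ_{Y ⊆ X} a_Y)` -/

section MayerSum

omit [DecidableEq ι] in
/-- the Mayer sum of a product of one-polymer factors: `Σ_{T ⊆ U} Π_{Y∈T} a_Y = Π_{Y∈U}(1 + a_Y)` ((5.11.2) read backwards).
[cite: BalabanImbrieJaffe1988, (5.11.2) p.299] -/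
theorem sum_powerset_prod_eq (U : Finset (Finset ι)) (a : Finset ι → ℝ) :
    ∑ T ∈ U.powerset, ∏ Y ∈ T, a Y = ∏ Y ∈ U, (1 + a Y) :=
  (prod_one_add (f := a) (s := U)).symm

omit [DecidableEq ι] in
/-- `Π_{Y∈U}(1 + a_Y) ≤ exp(Σ_{Y∈U} a_Y)` for `a ≥ 0` (p. 299 (5.11.3) sketch: *"Σ_n (…)ⁿ ≤ exp(…)"*). [cite: BalabanImbrieJaffe1988, p.307 (Sect. 5.13)] -/
theorem prod_one_add_le_exp_sum (U : Finset (Finset ι)) (a : Finset ι → ℝ) (ha : ∀ Y ∈ U, 0 ≤ a Y) :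
    ∏ Y ∈ U, (1 + a Y) ≤ Real.exp (∑ Y ∈ U, a Y) := by
  rw [Real.exp_sum]
  exact prod_le_prod (fun Y hY => by linarith [ha Y hY]) fun Y _ => by
    rw [add_comm]
    exact Real.add_one_le_exp (a Y)

variable (Ys : Finset (Finset ι))

/-- **any sub-sum over the Mayer data inside `X` is controlled by `Π_{Y⊆X}(1 + a_Y)`**: if each Mayer set `T` costs `|g X T| ≤ C·Π_{Y∈T} a_Y`
(one factor `a_Y ≥ 0` per polymer joined in, p. 307 ¶1), then `|Σ_{T ⊆ 𝒫(X), p T} g X T| ≤ C·Π_{Y ⊆ X}(1 + a_Y)`.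
[cite: BalabanImbrieJaffe1988, p.307 (Sect. 5.13)] -/
theorem abs_sum_filter_le (p : Finset (Finset ι) → Prop) [DecidablePred p] (g : Finset ι → Finset (Finset ι) → ℝ) (X : Finset ι) (C : ℝ)
    (a : Finset ι → ℝ) (hg : ∀ T ⊆ polysIn Ys X, |g X T| ≤ C * ∏ Y ∈ T, a Y) :
    |∑ T ∈ (polysIn Ys X).powerset.filter p, g X T| ≤ C * ∏ Y ∈ polysIn Ys X, (1 + a Y) :=
  calc |∑ T ∈ (polysIn Ys X).powerset.filter p, g X T|
      ≤ ∑ T ∈ (polysIn Ys X).powerset.filter p, |g X T| := abs_sum_le_sum_abs _ _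
    _ ≤ ∑ T ∈ (polysIn Ys X).powerset, |g X T| :=
        sum_le_sum_of_subset_of_nonneg (filter_subset _ _) fun _ _ _ => abs_nonneg _
    _ ≤ ∑ T ∈ (polysIn Ys X).powerset, C * ∏ Y ∈ T, a Y := sum_le_sum fun T hT => hg T (mem_powerset.1 hT)
    _ = C * ∏ Y ∈ polysIn Ys X, (1 + a Y) := by rw [← mul_sum, sum_powerset_prod_eq]

/-- **the resummed activity `g₂(X) = Σ_{S_Y,S_5 compatible} g₁(X)` is controlled by `Π_{Y⊆X}(1 + a_Y)`** (*"Estimating the sums over S_Y, S_5 …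
leads to combinatoric factors"*). [cite: BalabanImbrieJaffe1988, p.307 (Sect. 5.13)] -/
theorem abs_g2_le (g : Finset ι → Finset (Finset ι) → ℝ) (X : Finset ι) (C : ℝ) (a : Finset ι → ℝ)
    (hg : ∀ T ⊆ polysIn Ys X, |g X T| ≤ C * ∏ Y ∈ T, a Y) : |g2 Ys g X| ≤ C * ∏ Y ∈ polysIn Ys X, (1 + a Y) := by
  have h := abs_sum_filter_le Ys (fun _ => True) g X C a hg
  rwa [filter_true_of_mem (fun _ _ => trivial)] at h

variable (J₀ : Finset (Finset ι))

/-- species A of the resummed activity is controlled by the same factor. [cite: BalabanImbrieJaffe1988, p.307 (Sect. 5.13)] -/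
theorem abs_gA_le (g : Finset ι → Finset (Finset ι) → ℝ) (X : Finset ι) (C : ℝ) (a : Finset ι → ℝ)
    (hg : ∀ T ⊆ polysIn Ys X, |g X T| ≤ C * ∏ Y ∈ T, a Y) : |gA J₀ Ys g X| ≤ C * ∏ Y ∈ polysIn Ys X, (1 + a Y) :=
  abs_sum_filter_le Ys _ g X C a hg

/-- species B of the resummed activity is controlled by the same factor. [cite: BalabanImbrieJaffe1988, p.307 (Sect. 5.13)] -/
theorem abs_gB_le (g : Finset ι → Finset (Finset ι) → ℝ) (X : Finset ι) (C : ℝ) (a : Finset ι → ℝ)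
    (hg : ∀ T ⊆ polysIn Ys X, |g X T| ≤ C * ∏ Y ∈ T, a Y) : |gB J₀ Ys g X| ≤ C * ∏ Y ∈ polysIn Ys X, (1 + a Y) :=
  abs_sum_filter_le Ys _ g X C a hg

/-- **`|g₂(X)| ≤ C·exp(Σ_{Y ⊆ X} a_Y)`**. [cite: BalabanImbrieJaffe1988, p.307 (Sect. 5.13)] -/
theorem abs_g2_le_exp (g : Finset ι → Finset (Finset ι) → ℝ) (X : Finset ι) {C : ℝ} (hC : 0 ≤ C) (a : Finset ι → ℝ)
    (ha : ∀ Y ∈ polysIn Ys X, 0 ≤ a Y) (hg : ∀ T ⊆ polysIn Ys X, |g X T| ≤ C * ∏ Y ∈ T, a Y) :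
    |g2 Ys g X| ≤ C * Real.exp (∑ Y ∈ polysIn Ys X, a Y) :=
  (abs_g2_le Ys g X C a hg).trans (mul_le_mul_of_nonneg_left (prod_one_add_le_exp_sum _ a ha) hC)

end MayerSum

/-! ## §2 The per-cube count: `Σ_{Y ⊆ X} a_Y ≤ κ|X|`, hence the printed `exp(κ|X_α|)` -/

section PerCube

variable (Ys : Finset (Finset ι))

/-- a nonempty polymer inside `X` is counted at least once by the cubes of `X` (weights `≥ 0`). [cite: BalabanImbrieJaffe1988, p.307 (Sect. 5.13)] -/
theorem le_sum_ite_mem {X Y : Finset ι} (hYX : Y ⊆ X) (hY : Y.Nonempty) {t : ℝ} (ht : 0 ≤ t) :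
    t ≤ ∑ x ∈ X, (if x ∈ Y then t else 0) := by
  obtain ⟨y, hy⟩ := hY
  have h1 : (if y ∈ Y then t else 0) ≤ ∑ x ∈ X, (if x ∈ Y then t else 0) :=
    single_le_sum (f := fun x => if x ∈ Y then t else 0) (fun x _ => by split_ifs <;> simp [ht]) (hYX hy)
  rwa [if_pos hy] at h1

/-- **the per-cube count**: if every cube lies in Mayer polymers of total weight at most `κ` (`Σ_{Y ∋ x} a_Y ≤ κ`), then the polymers inside `X`
weigh at most `κ|X|`: `Σ_{Y ⊆ X} a_Y ≤ |X|·κ` (the exponent `(e^β(L^kε/ε₀)^{1/4−α})^{β′}|X_α|` of the printed combinatoric factor).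
[cite: BalabanImbrieJaffe1988, p.307 (Sect. 5.13)] -/
theorem sum_polysIn_le_card_mul (hYs : ∀ Y ∈ Ys, Y.Nonempty) (a : Finset ι → ℝ) (ha : ∀ Y ∈ Ys, 0 ≤ a Y) (X : Finset ι) (κ : ℝ)
    (hκ : ∀ x ∈ X, ∑ Y ∈ Ys.filter (fun Y => x ∈ Y), a Y ≤ κ) : ∑ Y ∈ polysIn Ys X, a Y ≤ X.card * κ := by
  calc ∑ Y ∈ polysIn Ys X, a Y
      ≤ ∑ Y ∈ polysIn Ys X, ∑ x ∈ X, (if x ∈ Y then a Y else 0) :=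
        sum_le_sum fun Y hY => le_sum_ite_mem (mem_polysIn.1 hY).2 (hYs Y (mem_polysIn.1 hY).1) (ha Y (mem_polysIn.1 hY).1)
    _ = ∑ x ∈ X, ∑ Y ∈ polysIn Ys X, (if x ∈ Y then a Y else 0) := sum_comm
    _ = ∑ x ∈ X, ∑ Y ∈ (polysIn Ys X).filter (fun Y => x ∈ Y), a Y := sum_congr rfl fun x _ => (sum_filter _ _).symm
    _ ≤ ∑ x ∈ X, ∑ Y ∈ Ys.filter (fun Y => x ∈ Y), a Y :=
        sum_le_sum fun x _ => sum_le_sum_of_subset_of_nonneg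
          (fun Y hY => mem_filter.2 ⟨(mem_polysIn.1 (mem_filter.1 hY).1).1, (mem_filter.1 hY).2⟩)
          fun Y hY _ => ha Y (mem_filter.1 hY).1
    _ ≤ ∑ x ∈ X, κ := sum_le_sum hκ
    _ = X.card * κ := by rw [sum_const, nsmul_eq_mul]

/-- **THE PRINTED COMBINATORIC FACTOR** (p. 307 [PDF 51], verbatim: *"Estimating the sums over S_Y, S_5, and the sums in the cluster expansion leads to
combinatoric factors exp((e^β(L^kε/ε₀)^{1/4−α})^{β′}|X_α|), β′ > 0."*) — the Mayer-sum half: under one factor `a_Y ≥ 0` per Mayer polymer joined into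
the cluster (`|g₁(X; T)| ≤ C·Π_{Y∈T} a_Y`, `C ≥ 0`) and total weight `≤ κ` of the polymers through any cube, the resummed activity obeys
`|g₂(X)| ≤ C·exp(κ|X|)` (`κ` = the printed `(e^β(L^kε/ε₀)^{1/4−α})^{β′}`). [cite: BalabanImbrieJaffe1988, p.307 (Sect. 5.13)] -/
theorem abs_g2_le_exp_card (hYs : ∀ Y ∈ Ys, Y.Nonempty) (g : Finset ι → Finset (Finset ι) → ℝ) (X : Finset ι) {C : ℝ} (hC : 0 ≤ C)
    (a : Finset ι → ℝ) (ha : ∀ Y ∈ Ys, 0 ≤ a Y) (κ : ℝ) (hκ : ∀ x ∈ X, ∑ Y ∈ Ys.filter (fun Y => x ∈ Y), a Y ≤ κ)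
    (hg : ∀ T ⊆ polysIn Ys X, |g X T| ≤ C * ∏ Y ∈ T, a Y) : |g2 Ys g X| ≤ C * Real.exp (κ * X.card) := by
  refine (abs_g2_le_exp Ys g X hC a (fun Y hY => ha Y (mem_polysIn.1 hY).1) hg).trans (mul_le_mul_of_nonneg_left ?_ hC)
  rw [Real.exp_le_exp, mul_comm]
  exact sum_polysIn_le_card_mul Ys hYs a ha X κ hκ

variable (J₀ : Finset (Finset ι))

/-- the same combinatoric factor for species A of the two-species bookkeeping. [cite: BalabanImbrieJaffe1988, p.307 (Sect. 5.13)] -/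
theorem abs_gA_le_exp_card (hYs : ∀ Y ∈ Ys, Y.Nonempty) (g : Finset ι → Finset (Finset ι) → ℝ) (X : Finset ι) {C : ℝ} (hC : 0 ≤ C)
    (a : Finset ι → ℝ) (ha : ∀ Y ∈ Ys, 0 ≤ a Y) (κ : ℝ) (hκ : ∀ x ∈ X, ∑ Y ∈ Ys.filter (fun Y => x ∈ Y), a Y ≤ κ)
    (hg : ∀ T ⊆ polysIn Ys X, |g X T| ≤ C * ∏ Y ∈ T, a Y) : |gA J₀ Ys g X| ≤ C * Real.exp (κ * X.card) := by
  refine (abs_gA_le Ys J₀ g X C a hg).trans (mul_le_mul_of_nonneg_left ?_ hC)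
  refine (prod_one_add_le_exp_sum _ a fun Y hY => ha Y (mem_polysIn.1 hY).1).trans ?_
  rw [Real.exp_le_exp, mul_comm]
  exact sum_polysIn_le_card_mul Ys hYs a ha X κ hκ

/-- the same combinatoric factor for species B of the two-species bookkeeping. [cite: BalabanImbrieJaffe1988, p.307 (Sect. 5.13)] -/
theorem abs_gB_le_exp_card (hYs : ∀ Y ∈ Ys, Y.Nonempty) (g : Finset ι → Finset (Finset ι) → ℝ) (X : Finset ι) {C : ℝ} (hC : 0 ≤ C)
    (a : Finset ι → ℝ) (ha : ∀ Y ∈ Ys, 0 ≤ a Y) (κ : ℝ) (hκ : ∀ x ∈ X, ∑ Y ∈ Ys.filter (fun Y => x ∈ Y), a Y ≤ κ)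
    (hg : ∀ T ⊆ polysIn Ys X, |g X T| ≤ C * ∏ Y ∈ T, a Y) : |gB J₀ Ys g X| ≤ C * Real.exp (κ * X.card) := by
  refine (abs_gB_le Ys J₀ g X C a hg).trans (mul_le_mul_of_nonneg_left ?_ hC)
  refine (prod_one_add_le_exp_sum _ a fun Y hY => ha Y (mem_polysIn.1 hY).1).trans ?_
  rw [Real.exp_le_exp, mul_comm]
  exact sum_polysIn_le_card_mul Ys hYs a ha X κ hκ

end PerCube

/-! ## §3 Over a filling the factors multiply to `exp(κ|Λ₁₀|)` — the *"naive pressure"* of p. 307 -/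

section Pressure

variable (Ys : Finset (Finset ι))

/-- over a filling `Q` of `W` the per-polymer factors `exp(κ|X|)` multiply to `exp(κ|W|)`. [cite: BalabanImbrieJaffe1988, p.307 (Sect. 5.14)] -/
theorem prod_exp_mul_card {W : Finset ι} {Q : Finset (Finset ι)} (hQ : IsSetPartition W Q) (κ : ℝ) :
    ∏ X ∈ Q, Real.exp (κ * X.card) = Real.exp (κ * W.card) := by
  rw [← Real.exp_sum, ← mul_sum, ← hQ.sum_card, Nat.cast_sum]

/-- **THE NAIVE PRESSURE** (p. 307 [PDF 51], §5.14 ¶1, verbatim: *"The estimates in the last section show that the basic volume dependence or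
pressure for our expansion is naively of the order of (e^β(L^kε/ε₀)^{1/4−α})^{β′}."*) — the Mayer-sum part: over a filling `Q` of `W`, the product of
the resummed activities is bounded by `(Π_{X∈Q} C_X)·exp(κ|W|)`. [cite: BalabanImbrieJaffe1988, p.307 (Sect. 5.14)] -/
theorem prod_abs_g2_le (hYs : ∀ Y ∈ Ys, Y.Nonempty) (g : Finset ι → Finset (Finset ι) → ℝ) {W : Finset ι} {Q : Finset (Finset ι)}
    (hQ : IsSetPartition W Q) (C : Finset ι → ℝ) (hC : ∀ X ∈ Q, 0 ≤ C X) (a : Finset ι → ℝ) (ha : ∀ Y ∈ Ys, 0 ≤ a Y) (κ : ℝ)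
    (hκ : ∀ x ∈ W, ∑ Y ∈ Ys.filter (fun Y => x ∈ Y), a Y ≤ κ)
    (hg : ∀ X ∈ Q, ∀ T ⊆ polysIn Ys X, |g X T| ≤ C X * ∏ Y ∈ T, a Y) :
    ∏ X ∈ Q, |g2 Ys g X| ≤ (∏ X ∈ Q, C X) * Real.exp (κ * W.card) := by
  rw [← prod_exp_mul_card hQ κ, ← prod_mul_distrib]
  exact prod_le_prod (fun X _ => abs_nonneg _) fun X hX =>
    abs_g2_le_exp_card Ys hYs g X (hC X hX) a ha κ (fun x hx => hκ x (hQ.subset hX hx)) (hg X hX)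

end Pressure

end Literature.MathematicalPhysics.QuantumFieldTheory.BalabanImbrieJaffe1984to88.BIJ88MayerCombinatoric307
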